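import Literature.Analysis.FluidPDE.LeiZhang2011Proofs
import HarnessLib

/-!
# Lei–Zhang 2011, §2: the slice estimates of the cut-off terms in the energy identity

Analysis/FluidPDE proofs file (theorems only), on the discharge path of the named fact
`Literature.Analysis.FluidPDE.LeiZhang2011_liouville` (Z. Lei, Q. S. Zhang, J. Funct. Anal. 261
(2011) = arXiv:1011.5066, Theorem 1.2, via Theorem 1.1, §2). The energy identity
(`LeiZhang2011.energy_identity`, file `LeiZhang2011Energy`) tested with `H'(F) φ²` has, at each
time, three cut-off terms: `−∫ H'(F)⟪∇F, ∇φ²⟩` (from the viscous term),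
`∫ H(F)⟪b, ∇φ²⟩` (transport, `b = curl B` a.e.) and `∫ (2/r) H(F) ∂ᵣφ²` (axis). Here they are
estimated at a fixed time, for a general convex `H ∈ C²` with `H ≥ 0` and the structure
condition `H'² ≤ κ H H''` (for the paper's `H(v) = |v|^{2q}`, `κ = 2q/(2q−1)`), against the good
term `∫ H''(F) ‖∇F‖² φ²` (the paper's `∬ |∇(fψ)|²`-type term, (2.3)–(2.4)):

* `LeiZhang2011.two_mul_abs_mul_mul_le` — the pointwise Young inequality
  `2|H'| A W ≤ ε H'' A² + (κ/ε) H W²`;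
* `LeiZhang2011.abs_integral_deriv_comp_inner_gradient_le` — the viscous cut-off term:
  `|∫ H'(F)⟪∇F, ∇φ²⟩| ≤ ε ∫ H''(F)‖∇F‖²φ² + (κ/ε) ∫ H(F) ‖∇φ‖²` ((2.3): "`2ψ∇ψ·f∇f`" by Cauchy–Schwarz);
* `LeiZhang2011.integral_comp_inner_gradient_sq_le` — the transport term through the stream
  function: `∫ H(F)⟪b, ∇φ²⟩ ≤ ε ∫ H''(F)‖∇F‖²φ² + (κ/ε) ∫ H(F) ‖B − c‖² ‖∇φ‖²` for every constant
  `c` (the paper's treatment of `b₂`, p. 6, before Hölder and John–Nirenberg);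
* `LeiZhang2011.integral_axis_term_nonpos` — for a radially non-increasing cut-off
  (`φ ∂ᵣφ ≤ 0`) the axis term `∫ (2/r) H(F) ∂ᵣ(φ²)` is `≤ 0` and can be dropped (the paper bounds
  it instead, (2.3); either way it is harmless);
* `LeiZhang2011.integral_comp_mul_norm_sub_sq_mul_norm_gradient_sq_le` — the Hölder step
  `∫ H(F)‖B − c‖²‖∇φ‖² ≤ ‖∇φ‖²_∞ ‖B − c‖²_{L⁶(K)} ‖H(F)‖_{L^{3/2}(K)}` preceding John–Nirenberg.

## References

* Z. Lei, Q. S. Zhang, J. Funct. Anal. 261 (2011) = arXiv:1011.5066, §2 (2.3)–(2.4) and the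
  estimates of the `bᵢ` terms, pp. 6–7. [LeiZhang2011]
-/

noncomputable section

open MeasureTheory Set Function Filter Metric
open _root_.Topology
open scoped InnerProductSpace RealInnerProductSpace NNReal ENNReal

namespace Literature.Analysis.FluidPDE

namespace LeiZhang2011

/-! ### Pointwise Young inequality under the structure condition `H'² ≤ κ H H''` -/

/-- **Young's inequality in the form used for the cut-off terms of (2.3)–(2.4).** For reals with
`ε > 0`, `κ, h₀, h₂ ≥ 0` and `h₁² ≤ κ h₀ h₂` (for `H(v) = |v|^{2q}`: `h₀ = H`, `h₁ = H'`,
`h₂ = H''`, `κ = 2q/(2q−1)`) and any reals `A, W`: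
`2 |h₁| A W ≤ ε h₂ A² + (κ/ε) h₀ W²`. [folklore] -/
theorem two_mul_abs_mul_mul_le {h₀ h₁ h₂ κ ε : ℝ} (A W : ℝ) (hε : 0 < ε) (hκ0 : 0 ≤ κ)
    (hh₀ : 0 ≤ h₀) (hh₂ : 0 ≤ h₂) (hκ : h₁ ^ 2 ≤ κ * h₀ * h₂) :
    2 * |h₁| * A * W ≤ ε * h₂ * A ^ 2 + κ / ε * h₀ * W ^ 2 := by
  rcases hh₂.eq_or_lt with h0 | hpos
  · -- `h₂ = 0` forces `h₁ = 0`
    have h1 : h₁ = 0 := by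
      have : h₁ ^ 2 ≤ 0 := by rw [← h0, mul_zero] at hκ; exact hκ
      nlinarith [sq_nonneg h₁]
    rw [h1, abs_zero, mul_zero, zero_mul, zero_mul, ← h0]
    have : 0 ≤ κ / ε * h₀ * W ^ 2 := by positivity
    linarith
  · -- `h₂ > 0`: `2|h₁|AW·h₂ ≤ ε h₂² A² + h₁² W²/ε ≤ ε h₂² A² + (κ/ε) h₀ h₂ W²`, then divide by `h₂`
    have key : 2 * |h₁| * A * W * h₂ ≤ ε * h₂ ^ 2 * A ^ 2 + h₁ ^ 2 * W ^ 2 / ε := by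
      have hsq := sq_nonneg (ε * h₂ * A - |h₁| * W)
      have habs : |h₁| ^ 2 = h₁ ^ 2 := sq_abs h₁
      have e : (ε * h₂ * A - |h₁| * W) ^ 2 =
          ε ^ 2 * h₂ ^ 2 * A ^ 2 - 2 * ε * (|h₁| * A * W * h₂) + h₁ ^ 2 * W ^ 2 := by
        rw [← habs]; ring
      have h0 : 0 ≤ ε⁻¹ * (ε * h₂ * A - |h₁| * W) ^ 2 := mul_nonneg (inv_nonneg.2 hε.le) hsq
      rw [e] at h0
      have e2 : ε⁻¹ * (ε ^ 2 * h₂ ^ 2 * A ^ 2 - 2 * ε * (|h₁| * A * W * h₂) + h₁ ^ 2 * W ^ 2) =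
          ε * h₂ ^ 2 * A ^ 2 - 2 * (|h₁| * A * W * h₂) + h₁ ^ 2 * W ^ 2 / ε := by
        field_simp
      rw [e2] at h0
      linarith
    have h2 : h₁ ^ 2 * W ^ 2 / ε ≤ κ * h₀ * h₂ * W ^ 2 / ε := by
      gcongr
    have h3 : 2 * |h₁| * A * W * h₂ ≤ (ε * h₂ * A ^ 2 + κ / ε * h₀ * W ^ 2) * h₂ := by
      calc 2 * |h₁| * A * W * h₂ ≤ ε * h₂ ^ 2 * A ^ 2 + κ * h₀ * h₂ * W ^ 2 / ε := key.trans (by linarith)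
        _ = (ε * h₂ * A ^ 2 + κ / ε * h₀ * W ^ 2) * h₂ := by ring
    exact le_of_mul_le_mul_right h3 hpos

/-! ### The viscous cut-off term -/

/-- **The viscous cut-off term** (Lei–Zhang 2011, (2.3): "`2ψ_R∇ψ_R · f∇f`" absorbed by
Cauchy–Schwarz): for `F ∈ C¹`, a convex `H ∈ C²` with `H ≥ 0` and `H'² ≤ κ H H''` (`κ ≥ 0`),
a cut-off `φ ∈ C¹_c` and `ε > 0`,
`|∫ H'(F)⟪∇F, ∇(φ²)⟫| ≤ ε ∫ H''(F)‖∇F‖²φ² + (κ/ε) ∫ H(F)‖∇φ‖²`. [cite: LeiZhang2011, §2 (2.3) (arXiv p. 6), the cut-off part of the viscous term] -/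
theorem abs_integral_deriv_comp_inner_gradient_le {F : EuclideanSpace ℝ (Fin 3) → ℝ}
    (hF : ContDiff ℝ 1 F) {H : ℝ → ℝ} (hH : ContDiff ℝ 2 H) (hH0 : ∀ v, 0 ≤ H v)
    (hH2 : ∀ v, 0 ≤ deriv (deriv H) v) {κ : ℝ} (hκ0 : 0 ≤ κ)
    (hκ : ∀ v, deriv H v ^ 2 ≤ κ * H v * deriv (deriv H) v)
    {φ : EuclideanSpace ℝ (Fin 3) → ℝ} (hφ : ContDiff ℝ 1 φ) (hφc : HasCompactSupport φ)
    {ε : ℝ} (hε : 0 < ε) :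
    |∫ x, deriv H (F x) * ⟪gradient F x, gradient (fun y => φ y ^ 2) x⟫| ≤
      ε * (∫ x, deriv (deriv H) (F x) * ‖gradient F x‖ ^ 2 * φ x ^ 2) +
        κ / ε * ∫ x, H (F x) * ‖gradient φ x‖ ^ 2 := by
  have hH' : ContDiff ℝ 1 (deriv H) := by
    have h2 : ContDiff ℝ (1 + 1) H := by rw [one_add_one_eq_two]; exact hH
    exact h2.deriv'
  have hH'' : Continuous (deriv (deriv H)) := hH'.continuous_deriv le_rfl
  -- `∇(φ²) = 2φ ∇φ`
  have hgrad2 : ∀ x, gradient (fun y => φ y ^ 2) x = (2 * φ x) • gradient φ x := by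
    intro x
    have hd : DifferentiableAt ℝ φ x := (hφ.differentiable one_ne_zero) x
    have h := gradient_comp_apply (H := fun t : ℝ => t ^ 2) (F := φ)
      ((differentiable_pow 2) (φ x)) hd
    simp only [deriv_pow_field, Nat.cast_ofNat, Nat.add_one_sub_one, pow_one] at h
    exact h
  -- pointwise Young
  have hpt : ∀ x, |deriv H (F x) * ⟪gradient F x, gradient (fun y => φ y ^ 2) x⟫| ≤
      ε * (deriv (deriv H) (F x) * ‖gradient F x‖ ^ 2 * φ x ^ 2) +
        κ / ε * (H (F x) * ‖gradient φ x‖ ^ 2) := by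
    intro x
    rw [hgrad2 x, inner_smul_right, abs_mul, abs_mul]
    have hCS : |⟪gradient F x, gradient φ x⟫| ≤ ‖gradient F x‖ * ‖gradient φ x‖ :=
      abs_real_inner_le_norm _ _
    have hY := two_mul_abs_mul_mul_le (‖gradient F x‖ * |φ x|) ‖gradient φ x‖ hε hκ0
      (hH0 (F x)) (hH2 (F x)) (hκ (F x))
    calc |deriv H (F x)| * (|2 * φ x| * |⟪gradient F x, gradient φ x⟫|)
        ≤ |deriv H (F x)| * (|2 * φ x| * (‖gradient F x‖ * ‖gradient φ x‖)) := by
          gcongr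
      _ = 2 * |deriv H (F x)| * (‖gradient F x‖ * |φ x|) * ‖gradient φ x‖ := by
          rw [abs_mul, abs_two]; ring
      _ ≤ ε * deriv (deriv H) (F x) * (‖gradient F x‖ * |φ x|) ^ 2 +
            κ / ε * H (F x) * ‖gradient φ x‖ ^ 2 := hY
      _ = _ := by rw [mul_pow, sq_abs]; ring
  -- integrability of the two right-hand sides (continuous with compact support)
  have hgradF : Continuous (gradient F) := continuous_gradient_of_contDiff hF
  have hgradφ : Continuous (gradient φ) := continuous_gradient_of_contDiff hφ
  have hc1 : Continuous fun x => deriv (deriv H) (F x) * ‖gradient F x‖ ^ 2 * φ x ^ 2 :=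
    ((hH''.comp hF.continuous).mul (hgradF.norm.pow 2)).mul (hφ.continuous.pow 2)
  have hc2 : Continuous fun x => H (F x) * ‖gradient φ x‖ ^ 2 :=
    (hH.continuous.comp hF.continuous).mul (hgradφ.norm.pow 2)
  have hφ2c : HasCompactSupport fun y => φ y ^ 2 :=
    hφc.comp_left (g := fun t : ℝ => t ^ 2) (by simp)
  have hi1 : Integrable (fun x => deriv (deriv H) (F x) * ‖gradient F x‖ ^ 2 * φ x ^ 2)
      (volume : Measure (EuclideanSpace ℝ (Fin 3))) :=
    hc1.integrable_of_hasCompactSupport hφ2c.mul_left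
  have hgradφc : HasCompactSupport (gradient φ) := by
    refine HasCompactSupport.intro hφc fun x hx => gradient_eq_zero_of_notMem_tsupport hx
  have hi2 : Integrable (fun x => H (F x) * ‖gradient φ x‖ ^ 2)
      (volume : Measure (EuclideanSpace ℝ (Fin 3))) := by
    refine hc2.integrable_of_hasCompactSupport ?_
    exact ((hgradφc.norm).comp_left (g := fun t : ℝ => t ^ 2) (by simp)).mul_left
  -- integrate
  calc |∫ x, deriv H (F x) * ⟪gradient F x, gradient (fun y => φ y ^ 2) x⟫|
      ≤ ∫ x, |deriv H (F x) * ⟪gradient F x, gradient (fun y => φ y ^ 2) x⟫| :=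
        abs_integral_le_integral_abs
    _ ≤ ∫ x, (ε * (deriv (deriv H) (F x) * ‖gradient F x‖ ^ 2 * φ x ^ 2) +
        κ / ε * (H (F x) * ‖gradient φ x‖ ^ 2)) := by
        refine integral_mono_of_nonneg (Eventually.of_forall fun x => abs_nonneg _)
          ((hi1.const_mul ε).add (hi2.const_mul (κ / ε))) (Eventually.of_forall hpt)
    _ = ε * (∫ x, deriv (deriv H) (F x) * ‖gradient F x‖ ^ 2 * φ x ^ 2) +
        κ / ε * ∫ x, H (F x) * ‖gradient φ x‖ ^ 2 := by
        rw [integral_add (hi1.const_mul ε) (hi2.const_mul (κ / ε)),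
          MeasureTheory.integral_const_mul, MeasureTheory.integral_const_mul]

/-! ### The transport term through the stream function -/

/-- **The transport term through the stream function** (Lei–Zhang 2011, §2, treatment of `b₂`,
p. 6, up to the Hölder/John–Nirenberg step): for `F ∈ C²`, a convex `H ∈ C²` with `H ≥ 0`,
`H'² ≤ κ H H''`, a cut-off `φ ∈ C²_c`, a locally integrable drift `b = curl B` a.e. with `B`
differentiable, every constant `c` and `ε > 0`,
`∫ H(F)⟪b, ∇(φ²)⟫ ≤ ε ∫ H''(F)‖∇F‖²φ² + (κ/ε) ∫ H(F) ‖B − c‖² ‖∇φ‖²`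
(`∫ H(F)⟪b, ∇φ²⟫ = ∫ ⟪B − c, ∇(H∘F) × ∇φ²⟫`, `|⟪B − c, ∇(H∘F) × ∇φ²⟫| ≤ ‖B − c‖ |H'(F)| ‖∇F‖ 2|φ|‖∇φ‖`,
Young). [cite: LeiZhang2011, §2 (arXiv p. 6), treatment of b₂] -/
theorem integral_comp_inner_gradient_sq_le {F : EuclideanSpace ℝ (Fin 3) → ℝ}
    (hF : ContDiff ℝ 2 F) {H : ℝ → ℝ} (hH : ContDiff ℝ 2 H) (hH0 : ∀ v, 0 ≤ H v)
    (hH2 : ∀ v, 0 ≤ deriv (deriv H) v) {κ : ℝ} (hκ0 : 0 ≤ κ)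
    (hκ : ∀ v, deriv H v ^ 2 ≤ κ * H v * deriv (deriv H) v)
    {φ : EuclideanSpace ℝ (Fin 3) → ℝ} (hφ : ContDiff ℝ 2 φ) (hφc : HasCompactSupport φ)
    {Bst : EuclideanSpace ℝ (Fin 3) → EuclideanSpace ℝ (Fin 3)} (hBst : Differentiable ℝ Bst)
    {b : EuclideanSpace ℝ (Fin 3) → EuclideanSpace ℝ (Fin 3)} (hb : curl Bst =ᵐ[volume] b)
    (hbi : LocallyIntegrable b volume) (c : EuclideanSpace ℝ (Fin 3)) {ε : ℝ} (hε : 0 < ε) :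
    ∫ x, H (F x) * ⟪b x, gradient (fun y => φ y ^ 2) x⟫ ≤
      ε * (∫ x, deriv (deriv H) (F x) * ‖gradient F x‖ ^ 2 * φ x ^ 2) +
        κ / ε * ∫ x, H (F x) * ‖Bst x - c‖ ^ 2 * ‖gradient φ x‖ ^ 2 := by
  have hH' : ContDiff ℝ 1 (deriv H) := by
    have h2 : ContDiff ℝ (1 + 1) H := by rw [one_add_one_eq_two]; exact hH
    exact h2.deriv'
  have hH'' : Continuous (deriv (deriv H)) := hH'.continuous_deriv le_rfl
  have hφ2c : HasCompactSupport fun y => φ y ^ 2 :=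
    hφc.comp_left (g := fun t : ℝ => t ^ 2) (by simp)
  -- through the stream function
  have hHF1 : ContDiff ℝ 1 fun x => H (F x) := (hH.comp hF).of_le (by norm_num)
  rw [integral_mul_inner_gradient_eq_integral_inner_sub_cross hBst hb hbi hHF1 (hφ.pow 2) hφ2c c]
  -- `∇(H∘F) = H'(F)∇F`, `∇(φ²) = 2φ∇φ`
  have hgradHF : ∀ x, gradient (fun y => H (F y)) x = deriv H (F x) • gradient F x := fun x =>
    gradient_comp_apply ((hH.differentiable two_ne_zero) (F x)) ((hF.differentiable two_ne_zero) x)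
  have hgrad2 : ∀ x, gradient (fun y => φ y ^ 2) x = (2 * φ x) • gradient φ x := by
    intro x
    have hd : DifferentiableAt ℝ φ x := (hφ.differentiable two_ne_zero) x
    have h := gradient_comp_apply (H := fun t : ℝ => t ^ 2) (F := φ)
      ((differentiable_pow 2) (φ x)) hd
    simp only [deriv_pow_field, Nat.cast_ofNat, Nat.add_one_sub_one, pow_one] at h
    exact h
  -- pointwise Young
  have hpt : ∀ x, ⟪Bst x - c, cross (gradient (fun y => H (F y)) x) (gradient (fun y => φ y ^ 2) x)⟫ ≤
      ε * (deriv (deriv H) (F x) * ‖gradient F x‖ ^ 2 * φ x ^ 2) +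
        κ / ε * (H (F x) * ‖Bst x - c‖ ^ 2 * ‖gradient φ x‖ ^ 2) := by
    intro x
    refine (le_abs_self _).trans ?_
    have h1 := abs_inner_sub_cross_gradient_le Bst c (fun y => H (F y)) (fun y => φ y ^ 2) x
    have hn1 : ‖gradient (fun y => H (F y)) x‖ = |deriv H (F x)| * ‖gradient F x‖ := by
      rw [hgradHF x, norm_smul, Real.norm_eq_abs]
    have hn2 : ‖gradient (fun y => φ y ^ 2) x‖ = 2 * |φ x| * ‖gradient φ x‖ := by
      rw [hgrad2 x, norm_smul, Real.norm_eq_abs, abs_mul, abs_two]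
    rw [hn1, hn2] at h1
    have hY := two_mul_abs_mul_mul_le (‖gradient F x‖ * |φ x|) (‖Bst x - c‖ * ‖gradient φ x‖) hε
      hκ0 (hH0 (F x)) (hH2 (F x)) (hκ (F x))
    calc |⟪Bst x - c, cross (gradient (fun y => H (F y)) x) (gradient (fun y => φ y ^ 2) x)⟫|
        ≤ ‖Bst x - c‖ * (|deriv H (F x)| * ‖gradient F x‖ * (2 * |φ x| * ‖gradient φ x‖)) := h1
      _ = 2 * |deriv H (F x)| * (‖gradient F x‖ * |φ x|) * (‖Bst x - c‖ * ‖gradient φ x‖) := by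
          ring
      _ ≤ ε * deriv (deriv H) (F x) * (‖gradient F x‖ * |φ x|) ^ 2 +
            κ / ε * H (F x) * (‖Bst x - c‖ * ‖gradient φ x‖) ^ 2 := hY
      _ = _ := by rw [mul_pow, mul_pow, sq_abs]; ring
  -- integrability of the two bounds
  have hgradF : Continuous (gradient F) := continuous_gradient_of_contDiff (hF.of_le one_le_two)
  have hgradφ : Continuous (gradient φ) := continuous_gradient_of_contDiff (hφ.of_le one_le_two)
  have hc1 : Continuous fun x => deriv (deriv H) (F x) * ‖gradient F x‖ ^ 2 * φ x ^ 2 :=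
    ((hH''.comp hF.continuous).mul (hgradF.norm.pow 2)).mul (hφ.continuous.pow 2)
  have hc2 : Continuous fun x => H (F x) * ‖Bst x - c‖ ^ 2 * ‖gradient φ x‖ ^ 2 :=
    ((hH.continuous.comp hF.continuous).mul
      ((hBst.continuous.sub continuous_const).norm.pow 2)).mul (hgradφ.norm.pow 2)
  have hi1 : Integrable (fun x => deriv (deriv H) (F x) * ‖gradient F x‖ ^ 2 * φ x ^ 2)
      (volume : Measure (EuclideanSpace ℝ (Fin 3))) :=
    hc1.integrable_of_hasCompactSupport hφ2c.mul_left
  have hgradφc : HasCompactSupport (gradient φ) := by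
    refine HasCompactSupport.intro hφc fun x hx => gradient_eq_zero_of_notMem_tsupport hx
  have hi2 : Integrable (fun x => H (F x) * ‖Bst x - c‖ ^ 2 * ‖gradient φ x‖ ^ 2)
      (volume : Measure (EuclideanSpace ℝ (Fin 3))) := by
    refine hc2.integrable_of_hasCompactSupport ?_
    exact ((hgradφc.norm).comp_left (g := fun t : ℝ => t ^ 2) (by simp)).mul_left
  -- the left-hand integrand is integrable (it is continuous with compact support)
  have hcrossc : Continuous fun x =>
      cross (gradient (fun y => H (F y)) x) (gradient (fun y => φ y ^ 2) x) := by
    have hgHF : Continuous (gradient fun y => H (F y)) := continuous_gradient_of_contDiff hHF1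
    have hg2 : Continuous (gradient fun y => φ y ^ 2) :=
      continuous_gradient_of_contDiff ((hφ.pow 2).of_le one_le_two)
    have : (fun x => cross (gradient (fun y => H (F y)) x) (gradient (fun y => φ y ^ 2) x)) =
        fun x => crossCLM (gradient (fun y => H (F y)) x) (gradient (fun y => φ y ^ 2) x) :=
      funext fun x => (crossCLM_apply _ _).symm
    rw [this]
    exact crossCLM.continuous₂.comp (hgHF.prodMk hg2)
  have hiL : Integrable (fun x =>
      ⟪Bst x - c, cross (gradient (fun y => H (F y)) x) (gradient (fun y => φ y ^ 2) x)⟫)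
      (volume : Measure (EuclideanSpace ℝ (Fin 3))) := by
    refine ((hBst.continuous.sub continuous_const).inner hcrossc).integrable_of_hasCompactSupport
      (HasCompactSupport.intro hφc fun x hx => ?_)
    have : gradient (fun y => φ y ^ 2) x = 0 := by
      rw [hgrad2 x, gradient_eq_zero_of_notMem_tsupport hx, smul_zero]
    simp [this, cross]
  calc ∫ x, ⟪Bst x - c, cross (gradient (fun y => H (F y)) x) (gradient (fun y => φ y ^ 2) x)⟫
      ≤ ∫ x, (ε * (deriv (deriv H) (F x) * ‖gradient F x‖ ^ 2 * φ x ^ 2) +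
          κ / ε * (H (F x) * ‖Bst x - c‖ ^ 2 * ‖gradient φ x‖ ^ 2)) :=
        integral_mono hiL ((hi1.const_mul ε).add (hi2.const_mul (κ / ε))) hpt
    _ = _ := by
        rw [integral_add (hi1.const_mul ε) (hi2.const_mul (κ / ε)),
          MeasureTheory.integral_const_mul, MeasureTheory.integral_const_mul]

/-! ### The axis term has a sign for radially non-increasing cut-offs -/

/-- **The axis term is non-positive for a radially non-increasing cut-off**: if `H ≥ 0` and
`φ ∂ᵣφ ≤ 0` pointwise (e.g. `φ = θ(|x|)` with `θ` non-increasing and `φ ≥ 0`), then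
`∫ (2/r) H(F) ∂ᵣ(φ²) dx ≤ 0` (pointwise `∂ᵣ(φ²) = 2φ ∂ᵣφ ≤ 0`, `2/r ≥ 0`). In Lei–Zhang 2011,
(2.3), this term is instead bounded by `C/((σ₁−σ₂)²R²)∬f²`; with a radial cut-off it can simply
be dropped. [cite: LeiZhang2011, §2 (2.3) (arXiv p. 6), the axis term] -/
theorem integral_axis_term_nonpos {F : EuclideanSpace ℝ (Fin 3) → ℝ} {H : ℝ → ℝ}
    (hH0 : ∀ v, 0 ≤ H v) {φ : EuclideanSpace ℝ (Fin 3) → ℝ} (hφd : Differentiable ℝ φ)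
    (hφr : ∀ x, φ x * fderiv ℝ φ x (eR x) ≤ 0) :
    ∫ x, 2 / cylRadius x * (H (F x) * fderiv ℝ (fun y => φ y ^ 2) x (eR x)) ≤ 0 := by
  refine integral_nonpos fun x => ?_
  have hd : fderiv ℝ (fun y => φ y ^ 2) x (eR x) = 2 * φ x * fderiv ℝ φ x (eR x) := by
    have h := ((hφd x).hasFDerivAt.pow 2).fderiv
    rw [h]
    simp
  rw [hd]
  have h2r : 0 ≤ 2 / cylRadius x := div_nonneg zero_le_two (cylRadius_nonneg x)
  have hin : H (F x) * (2 * φ x * fderiv ℝ φ x (eR x)) ≤ 0 := by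
    have := hφr x
    have hH := hH0 (F x)
    nlinarith
  exact mul_nonpos_of_nonneg_of_nonpos h2r hin

/-! ### The Hölder step for the transport term -/

/-- **Hölder for the transport term** (Lei–Zhang 2011, p. 7: "`‖(B − B̄)f‖_{L²} ≤ ‖f‖_{L³}‖B − B̄‖_{L⁶}`",
here slice-wise and for a general `H ≥ 0` in place of `f²`): if the cut-off `φ ∈ C¹` is
supported in a compact set `K` with `‖∇φ‖ ≤ D`, then for continuous `B`, `F`, `H`,
`∫ H(F) ‖B − c‖² ‖∇φ‖² ≤ D² (∫_K (‖B − c‖²)³)^{1/3} (∫_K H(F)^{3/2})^{2/3}` (Hölder with exponents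
`3` and `3/2` on `K`). Combined with the John–Nirenberg bound
`‖B − B̄_K‖_{L⁶(K)} ≤ C ‖B‖_* |K|^{1/6}` (`exists_eLpNorm_sub_average_le`) this is the `b₂`
estimate of (2.4). [cite: LeiZhang2011, §2 (arXiv p. 7), Hölder before (BMOLp)] -/
theorem integral_comp_mul_norm_sub_sq_mul_norm_gradient_sq_le
    {F : EuclideanSpace ℝ (Fin 3) → ℝ} (hF : Continuous F) {H : ℝ → ℝ} (hH : Continuous H)
    (hH0 : ∀ v, 0 ≤ H v) {φ : EuclideanSpace ℝ (Fin 3) → ℝ} (hφ : ContDiff ℝ 1 φ)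
    {K : Set (EuclideanSpace ℝ (Fin 3))} (hK : IsCompact K) (hKφ : tsupport φ ⊆ K)
    {D : ℝ} (hD : ∀ x, ‖gradient φ x‖ ≤ D)
    {Bst : EuclideanSpace ℝ (Fin 3) → EuclideanSpace ℝ (Fin 3)} (hBst : Continuous Bst)
    (c : EuclideanSpace ℝ (Fin 3)) :
    ∫ x, H (F x) * ‖Bst x - c‖ ^ 2 * ‖gradient φ x‖ ^ 2 ≤
      D ^ 2 * ((∫ x in K, (‖Bst x - c‖ ^ 2) ^ (3 : ℝ)) ^ (1 / (3 : ℝ)) *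
        (∫ x in K, H (F x) ^ ((3 : ℝ) / 2)) ^ (1 / ((3 : ℝ) / 2))) := by
  have hD0 : 0 ≤ D := (norm_nonneg _).trans (hD 0)
  -- restrict to `K`: `∇φ = 0` off `tsupport φ ⊆ K`
  have hsupp : ∀ x, x ∉ K → H (F x) * ‖Bst x - c‖ ^ 2 * ‖gradient φ x‖ ^ 2 = 0 := by
    intro x hx
    rw [gradient_eq_zero_of_notMem_tsupport fun h => hx (hKφ h), norm_zero]
    ring
  rw [← setIntegral_eq_integral_of_forall_compl_eq_zero hsupp]
  -- finite measure on `K`, bounded continuous integrands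
  haveI : IsFiniteMeasure (volume.restrict K) := ⟨by
    rw [Measure.restrict_apply_univ]; exact hK.measure_lt_top⟩
  set f : EuclideanSpace ℝ (Fin 3) → ℝ := fun x => ‖Bst x - c‖ ^ 2 with hf
  set g : EuclideanSpace ℝ (Fin 3) → ℝ := fun x => H (F x) with hg
  have hfc : Continuous f := (hBst.sub continuous_const).norm.pow 2
  have hgc : Continuous g := hH.comp hF
  have hf0 : ∀ x, 0 ≤ f x := fun x => by positivity
  have hg0 : ∀ x, 0 ≤ g x := fun x => hH0 (F x)
  obtain ⟨Cf, hCf⟩ := hK.exists_bound_of_continuousOn hfc.continuousOn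
  obtain ⟨Cg, hCg⟩ := hK.exists_bound_of_continuousOn hgc.continuousOn
  have hfm : MemLp f (ENNReal.ofReal 3) (volume.restrict K) :=
    MemLp.of_bound hfc.aestronglyMeasurable Cf
      ((ae_restrict_iff' hK.measurableSet).2 (Eventually.of_forall hCf))
  have hgm : MemLp g (ENNReal.ofReal (3 / 2)) (volume.restrict K) :=
    MemLp.of_bound hgc.aestronglyMeasurable Cg
      ((ae_restrict_iff' hK.measurableSet).2 (Eventually.of_forall hCg))
  have hpq : Real.HolderConjugate 3 (3 / 2) := ⟨by norm_num, by norm_num, by norm_num⟩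
  have hHolder := integral_mul_le_Lp_mul_Lq_of_nonneg hpq (Eventually.of_forall hf0)
    (Eventually.of_forall hg0) hfm hgm
  -- pointwise `H ‖B−c‖² ‖∇φ‖² ≤ D² · f g`
  have hpt : ∀ x, H (F x) * ‖Bst x - c‖ ^ 2 * ‖gradient φ x‖ ^ 2 ≤ D ^ 2 * (f x * g x) := by
    intro x
    have h1 : ‖gradient φ x‖ ^ 2 ≤ D ^ 2 := pow_le_pow_left₀ (norm_nonneg _) (hD x) 2
    have h2 : 0 ≤ H (F x) * ‖Bst x - c‖ ^ 2 := mul_nonneg (hH0 _) (by positivity)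
    calc H (F x) * ‖Bst x - c‖ ^ 2 * ‖gradient φ x‖ ^ 2 ≤ H (F x) * ‖Bst x - c‖ ^ 2 * D ^ 2 :=
          mul_le_mul_of_nonneg_left h1 h2
      _ = D ^ 2 * (f x * g x) := by simp only [hf, hg]; ring
  have hgradφ : Continuous (gradient φ) := continuous_gradient_of_contDiff hφ
  have hLc : Continuous fun x => H (F x) * ‖Bst x - c‖ ^ 2 * ‖gradient φ x‖ ^ 2 :=
    (hgc.mul hfc).mul (hgradφ.norm.pow 2)
  have hLi : IntegrableOn (fun x => H (F x) * ‖Bst x - c‖ ^ 2 * ‖gradient φ x‖ ^ 2) K :=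
    hLc.continuousOn.integrableOn_compact hK
  have hRi : IntegrableOn (fun x => D ^ 2 * (f x * g x)) K :=
    ((hfc.mul hgc).continuousOn.integrableOn_compact hK).const_mul _
  calc ∫ x in K, H (F x) * ‖Bst x - c‖ ^ 2 * ‖gradient φ x‖ ^ 2
      ≤ ∫ x in K, D ^ 2 * (f x * g x) := setIntegral_mono hLi hRi hpt
    _ = D ^ 2 * ∫ x in K, f x * g x := MeasureTheory.integral_const_mul _ _
    _ ≤ D ^ 2 * ((∫ x in K, f x ^ (3 : ℝ)) ^ (1 / (3 : ℝ)) *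
        (∫ x in K, g x ^ ((3 : ℝ) / 2)) ^ (1 / ((3 : ℝ) / 2))) :=
        mul_le_mul_of_nonneg_left hHolder (pow_nonneg hD0 2)

end LeiZhang2011

end Literature.Analysis.FluidPDE

namespace Literature.Analysis.FluidPDE

namespace LeiZhang2011

/-! ### General-weight versions (for the concave and logarithmic nonlinearities of §3) -/

/-- **The viscous cut-off term, general weight.** Same as `abs_integral_deriv_comp_inner_gradient_le`
with the good weight `H''` replaced by any continuous `Gw ≥ 0` such that `H'² ≤ κ H Gw`
(`H ∈ C¹` only); used with the concave powers `H = v^p`, `p < 1` (`Gw = |H''|`, Lemma 3.4) and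
`H = −log` (`Gw = H'²`, Lemma 3.2) of Lei–Zhang 2011, §3. Original: **The viscous cut-off term** (Lei–Zhang 2011, (2.3): "`2ψ_R∇ψ_R · f∇f`" absorbed by
Cauchy–Schwarz): for `F ∈ C¹`, a convex `H ∈ C²` with `H ≥ 0` and `H'² ≤ κ H H''` (`κ ≥ 0`),
a cut-off `φ ∈ C¹_c` and `ε > 0`,
`|∫ H'(F)⟪∇F, ∇(φ²)⟫| ≤ ε ∫ H''(F)‖∇F‖²φ² + (κ/ε) ∫ H(F)‖∇φ‖²`. [cite: LeiZhang2011, §2 (2.3) (arXiv p. 6), the cut-off part of the viscous term] -/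
theorem abs_integral_deriv_comp_inner_gradient_le_weight {F : EuclideanSpace ℝ (Fin 3) → ℝ}
    (hF : ContDiff ℝ 1 F) {H Gw : ℝ → ℝ} (hH : ContDiff ℝ 1 H) (hH0 : ∀ v, 0 ≤ H v)
    (hGwc : Continuous Gw) (hGw0 : ∀ v, 0 ≤ Gw v) {κ : ℝ} (hκ0 : 0 ≤ κ)
    (hκ : ∀ v, deriv H v ^ 2 ≤ κ * H v * Gw v)
    {φ : EuclideanSpace ℝ (Fin 3) → ℝ} (hφ : ContDiff ℝ 1 φ) (hφc : HasCompactSupport φ)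
    {ε : ℝ} (hε : 0 < ε) :
    |∫ x, deriv H (F x) * ⟪gradient F x, gradient (fun y => φ y ^ 2) x⟫| ≤
      ε * (∫ x, Gw (F x) * ‖gradient F x‖ ^ 2 * φ x ^ 2) +
        κ / ε * ∫ x, H (F x) * ‖gradient φ x‖ ^ 2 := by
  -- `∇(φ²) = 2φ ∇φ`
  have hgrad2 : ∀ x, gradient (fun y => φ y ^ 2) x = (2 * φ x) • gradient φ x := by
    intro x
    have hd : DifferentiableAt ℝ φ x := (hφ.differentiable one_ne_zero) x
    have h := gradient_comp_apply (H := fun t : ℝ => t ^ 2) (F := φ)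
      ((differentiable_pow 2) (φ x)) hd
    simp only [deriv_pow_field, Nat.cast_ofNat, Nat.add_one_sub_one, pow_one] at h
    exact h
  -- pointwise Young
  have hpt : ∀ x, |deriv H (F x) * ⟪gradient F x, gradient (fun y => φ y ^ 2) x⟫| ≤
      ε * (Gw (F x) * ‖gradient F x‖ ^ 2 * φ x ^ 2) +
        κ / ε * (H (F x) * ‖gradient φ x‖ ^ 2) := by
    intro x
    rw [hgrad2 x, inner_smul_right, abs_mul, abs_mul]
    have hCS : |⟪gradient F x, gradient φ x⟫| ≤ ‖gradient F x‖ * ‖gradient φ x‖ :=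
      abs_real_inner_le_norm _ _
    have hY := two_mul_abs_mul_mul_le (‖gradient F x‖ * |φ x|) ‖gradient φ x‖ hε hκ0
      (hH0 (F x)) (hGw0 (F x)) (hκ (F x))
    calc |deriv H (F x)| * (|2 * φ x| * |⟪gradient F x, gradient φ x⟫|)
        ≤ |deriv H (F x)| * (|2 * φ x| * (‖gradient F x‖ * ‖gradient φ x‖)) := by
          gcongr
      _ = 2 * |deriv H (F x)| * (‖gradient F x‖ * |φ x|) * ‖gradient φ x‖ := by
          rw [abs_mul, abs_two]; ring
      _ ≤ ε * Gw (F x) * (‖gradient F x‖ * |φ x|) ^ 2 +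
            κ / ε * H (F x) * ‖gradient φ x‖ ^ 2 := hY
      _ = _ := by rw [mul_pow, sq_abs]; ring
  -- integrability of the two right-hand sides (continuous with compact support)
  have hgradF : Continuous (gradient F) := continuous_gradient_of_contDiff hF
  have hgradφ : Continuous (gradient φ) := continuous_gradient_of_contDiff hφ
  have hc1 : Continuous fun x => Gw (F x) * ‖gradient F x‖ ^ 2 * φ x ^ 2 :=
    ((hGwc.comp hF.continuous).mul (hgradF.norm.pow 2)).mul (hφ.continuous.pow 2)
  have hc2 : Continuous fun x => H (F x) * ‖gradient φ x‖ ^ 2 :=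
    (hH.continuous.comp hF.continuous).mul (hgradφ.norm.pow 2)
  have hφ2c : HasCompactSupport fun y => φ y ^ 2 :=
    hφc.comp_left (g := fun t : ℝ => t ^ 2) (by simp)
  have hi1 : Integrable (fun x => Gw (F x) * ‖gradient F x‖ ^ 2 * φ x ^ 2)
      (volume : Measure (EuclideanSpace ℝ (Fin 3))) :=
    hc1.integrable_of_hasCompactSupport hφ2c.mul_left
  have hgradφc : HasCompactSupport (gradient φ) := by
    refine HasCompactSupport.intro hφc fun x hx => gradient_eq_zero_of_notMem_tsupport hx
  have hi2 : Integrable (fun x => H (F x) * ‖gradient φ x‖ ^ 2)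
      (volume : Measure (EuclideanSpace ℝ (Fin 3))) := by
    refine hc2.integrable_of_hasCompactSupport ?_
    exact ((hgradφc.norm).comp_left (g := fun t : ℝ => t ^ 2) (by simp)).mul_left
  -- integrate
  calc |∫ x, deriv H (F x) * ⟪gradient F x, gradient (fun y => φ y ^ 2) x⟫|
      ≤ ∫ x, |deriv H (F x) * ⟪gradient F x, gradient (fun y => φ y ^ 2) x⟫| :=
        abs_integral_le_integral_abs
    _ ≤ ∫ x, (ε * (Gw (F x) * ‖gradient F x‖ ^ 2 * φ x ^ 2) +
        κ / ε * (H (F x) * ‖gradient φ x‖ ^ 2)) := by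
        refine integral_mono_of_nonneg (Eventually.of_forall fun x => abs_nonneg _)
          ((hi1.const_mul ε).add (hi2.const_mul (κ / ε))) (Eventually.of_forall hpt)
    _ = ε * (∫ x, Gw (F x) * ‖gradient F x‖ ^ 2 * φ x ^ 2) +
        κ / ε * ∫ x, H (F x) * ‖gradient φ x‖ ^ 2 := by
        rw [integral_add (hi1.const_mul ε) (hi2.const_mul (κ / ε)),
          MeasureTheory.integral_const_mul, MeasureTheory.integral_const_mul]


/-- **The transport term through the stream function, general weight.** Same as
`integral_comp_inner_gradient_sq_le` with `H''` replaced by any continuous `Gw ≥ 0` with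
`H'² ≤ κ H Gw` (`H ∈ C¹`); for the concave/logarithmic nonlinearities of Lei–Zhang 2011, §3.
Original: **The transport term through the stream function** (Lei–Zhang 2011, §2, treatment of `b₂`,
p. 6, up to the Hölder/John–Nirenberg step): for `F ∈ C²`, a convex `H ∈ C²` with `H ≥ 0`,
`H'² ≤ κ H H''`, a cut-off `φ ∈ C²_c`, a locally integrable drift `b = curl B` a.e. with `B`
differentiable, every constant `c` and `ε > 0`,
`∫ H(F)⟪b, ∇(φ²)⟫ ≤ ε ∫ H''(F)‖∇F‖²φ² + (κ/ε) ∫ H(F) ‖B − c‖² ‖∇φ‖²`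
(`∫ H(F)⟪b, ∇φ²⟫ = ∫ ⟪B − c, ∇(H∘F) × ∇φ²⟫`, `|⟪B − c, ∇(H∘F) × ∇φ²⟫| ≤ ‖B − c‖ |H'(F)| ‖∇F‖ 2|φ|‖∇φ‖`,
Young). [cite: LeiZhang2011, §2 (arXiv p. 6), treatment of b₂] -/
theorem integral_comp_inner_gradient_sq_le_weight {F : EuclideanSpace ℝ (Fin 3) → ℝ}
    (hF : ContDiff ℝ 2 F) {H Gw : ℝ → ℝ} (hH : ContDiff ℝ 1 H) (hH0 : ∀ v, 0 ≤ H v)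
    (hGwc : Continuous Gw) (hGw0 : ∀ v, 0 ≤ Gw v) {κ : ℝ} (hκ0 : 0 ≤ κ)
    (hκ : ∀ v, deriv H v ^ 2 ≤ κ * H v * Gw v)
    {φ : EuclideanSpace ℝ (Fin 3) → ℝ} (hφ : ContDiff ℝ 2 φ) (hφc : HasCompactSupport φ)
    {Bst : EuclideanSpace ℝ (Fin 3) → EuclideanSpace ℝ (Fin 3)} (hBst : Differentiable ℝ Bst)
    {b : EuclideanSpace ℝ (Fin 3) → EuclideanSpace ℝ (Fin 3)} (hb : curl Bst =ᵐ[volume] b)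
    (hbi : LocallyIntegrable b volume) (c : EuclideanSpace ℝ (Fin 3)) {ε : ℝ} (hε : 0 < ε) :
    ∫ x, H (F x) * ⟪b x, gradient (fun y => φ y ^ 2) x⟫ ≤
      ε * (∫ x, Gw (F x) * ‖gradient F x‖ ^ 2 * φ x ^ 2) +
        κ / ε * ∫ x, H (F x) * ‖Bst x - c‖ ^ 2 * ‖gradient φ x‖ ^ 2 := by
  have hφ2c : HasCompactSupport fun y => φ y ^ 2 :=
    hφc.comp_left (g := fun t : ℝ => t ^ 2) (by simp)
  -- through the stream function
  have hHF1 : ContDiff ℝ 1 fun x => H (F x) := hH.comp (hF.of_le one_le_two)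
  rw [integral_mul_inner_gradient_eq_integral_inner_sub_cross hBst hb hbi hHF1 (hφ.pow 2) hφ2c c]
  -- `∇(H∘F) = H'(F)∇F`, `∇(φ²) = 2φ∇φ`
  have hgradHF : ∀ x, gradient (fun y => H (F y)) x = deriv H (F x) • gradient F x := fun x =>
    gradient_comp_apply ((hH.differentiable one_ne_zero) (F x)) ((hF.differentiable two_ne_zero) x)
  have hgrad2 : ∀ x, gradient (fun y => φ y ^ 2) x = (2 * φ x) • gradient φ x := by
    intro x
    have hd : DifferentiableAt ℝ φ x := (hφ.differentiable two_ne_zero) x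
    have h := gradient_comp_apply (H := fun t : ℝ => t ^ 2) (F := φ)
      ((differentiable_pow 2) (φ x)) hd
    simp only [deriv_pow_field, Nat.cast_ofNat, Nat.add_one_sub_one, pow_one] at h
    exact h
  -- pointwise Young
  have hpt : ∀ x, ⟪Bst x - c, cross (gradient (fun y => H (F y)) x) (gradient (fun y => φ y ^ 2) x)⟫ ≤
      ε * (Gw (F x) * ‖gradient F x‖ ^ 2 * φ x ^ 2) +
        κ / ε * (H (F x) * ‖Bst x - c‖ ^ 2 * ‖gradient φ x‖ ^ 2) := by
    intro x
    refine (le_abs_self _).trans ?_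
    have h1 := abs_inner_sub_cross_gradient_le Bst c (fun y => H (F y)) (fun y => φ y ^ 2) x
    have hn1 : ‖gradient (fun y => H (F y)) x‖ = |deriv H (F x)| * ‖gradient F x‖ := by
      rw [hgradHF x, norm_smul, Real.norm_eq_abs]
    have hn2 : ‖gradient (fun y => φ y ^ 2) x‖ = 2 * |φ x| * ‖gradient φ x‖ := by
      rw [hgrad2 x, norm_smul, Real.norm_eq_abs, abs_mul, abs_two]
    rw [hn1, hn2] at h1
    have hY := two_mul_abs_mul_mul_le (‖gradient F x‖ * |φ x|) (‖Bst x - c‖ * ‖gradient φ x‖) hε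
      hκ0 (hH0 (F x)) (hGw0 (F x)) (hκ (F x))
    calc |⟪Bst x - c, cross (gradient (fun y => H (F y)) x) (gradient (fun y => φ y ^ 2) x)⟫|
        ≤ ‖Bst x - c‖ * (|deriv H (F x)| * ‖gradient F x‖ * (2 * |φ x| * ‖gradient φ x‖)) := h1
      _ = 2 * |deriv H (F x)| * (‖gradient F x‖ * |φ x|) * (‖Bst x - c‖ * ‖gradient φ x‖) := by
          ring
      _ ≤ ε * Gw (F x) * (‖gradient F x‖ * |φ x|) ^ 2 +
            κ / ε * H (F x) * (‖Bst x - c‖ * ‖gradient φ x‖) ^ 2 := hY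
      _ = _ := by rw [mul_pow, mul_pow, sq_abs]; ring
  -- integrability of the two bounds
  have hgradF : Continuous (gradient F) := continuous_gradient_of_contDiff (hF.of_le one_le_two)
  have hgradφ : Continuous (gradient φ) := continuous_gradient_of_contDiff (hφ.of_le one_le_two)
  have hc1 : Continuous fun x => Gw (F x) * ‖gradient F x‖ ^ 2 * φ x ^ 2 :=
    ((hGwc.comp hF.continuous).mul (hgradF.norm.pow 2)).mul (hφ.continuous.pow 2)
  have hc2 : Continuous fun x => H (F x) * ‖Bst x - c‖ ^ 2 * ‖gradient φ x‖ ^ 2 :=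
    ((hH.continuous.comp hF.continuous).mul
      ((hBst.continuous.sub continuous_const).norm.pow 2)).mul (hgradφ.norm.pow 2)
  have hi1 : Integrable (fun x => Gw (F x) * ‖gradient F x‖ ^ 2 * φ x ^ 2)
      (volume : Measure (EuclideanSpace ℝ (Fin 3))) :=
    hc1.integrable_of_hasCompactSupport hφ2c.mul_left
  have hgradφc : HasCompactSupport (gradient φ) := by
    refine HasCompactSupport.intro hφc fun x hx => gradient_eq_zero_of_notMem_tsupport hx
  have hi2 : Integrable (fun x => H (F x) * ‖Bst x - c‖ ^ 2 * ‖gradient φ x‖ ^ 2)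
      (volume : Measure (EuclideanSpace ℝ (Fin 3))) := by
    refine hc2.integrable_of_hasCompactSupport ?_
    exact ((hgradφc.norm).comp_left (g := fun t : ℝ => t ^ 2) (by simp)).mul_left
  -- the left-hand integrand is integrable (it is continuous with compact support)
  have hcrossc : Continuous fun x =>
      cross (gradient (fun y => H (F y)) x) (gradient (fun y => φ y ^ 2) x) := by
    have hgHF : Continuous (gradient fun y => H (F y)) := continuous_gradient_of_contDiff hHF1
    have hg2 : Continuous (gradient fun y => φ y ^ 2) :=
      continuous_gradient_of_contDiff ((hφ.pow 2).of_le one_le_two)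
    have : (fun x => cross (gradient (fun y => H (F y)) x) (gradient (fun y => φ y ^ 2) x)) =
        fun x => crossCLM (gradient (fun y => H (F y)) x) (gradient (fun y => φ y ^ 2) x) :=
      funext fun x => (crossCLM_apply _ _).symm
    rw [this]
    exact crossCLM.continuous₂.comp (hgHF.prodMk hg2)
  have hiL : Integrable (fun x =>
      ⟪Bst x - c, cross (gradient (fun y => H (F y)) x) (gradient (fun y => φ y ^ 2) x)⟫)
      (volume : Measure (EuclideanSpace ℝ (Fin 3))) := by
    refine ((hBst.continuous.sub continuous_const).inner hcrossc).integrable_of_hasCompactSupport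
      (HasCompactSupport.intro hφc fun x hx => ?_)
    have : gradient (fun y => φ y ^ 2) x = 0 := by
      rw [hgrad2 x, gradient_eq_zero_of_notMem_tsupport hx, smul_zero]
    simp [this, cross]
  calc ∫ x, ⟪Bst x - c, cross (gradient (fun y => H (F y)) x) (gradient (fun y => φ y ^ 2) x)⟫
      ≤ ∫ x, (ε * (Gw (F x) * ‖gradient F x‖ ^ 2 * φ x ^ 2) +
          κ / ε * (H (F x) * ‖Bst x - c‖ ^ 2 * ‖gradient φ x‖ ^ 2)) :=
        integral_mono hiL ((hi1.const_mul ε).add (hi2.const_mul (κ / ε))) hpt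
    _ = _ := by
        rw [integral_add (hi1.const_mul ε) (hi2.const_mul (κ / ε)),
          MeasureTheory.integral_const_mul, MeasureTheory.integral_const_mul]


end LeiZhang2011

end Literature.Analysis.FluidPDE

namespace Literature.Analysis.FluidPDE

namespace LeiZhang2011

/-- **The transport term through the stream function, general weight, two-sided.** The absolute
value version of `integral_comp_inner_gradient_sq_le_weight` (the pointwise Young bound is
two-sided); needed when the transport term enters with the opposite sign (Lemma 3.4 of
Lei–Zhang 2011). Original: **The transport term through the stream function, general weight.** Same as
`integral_comp_inner_gradient_sq_le` with `H''` replaced by any continuous `Gw ≥ 0` with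
`H'² ≤ κ H Gw` (`H ∈ C¹`); for the concave/logarithmic nonlinearities of Lei–Zhang 2011, §3.
Original: **The transport term through the stream function** (Lei–Zhang 2011, §2, treatment of `b₂`,
p. 6, up to the Hölder/John–Nirenberg step): for `F ∈ C²`, a convex `H ∈ C²` with `H ≥ 0`,
`H'² ≤ κ H H''`, a cut-off `φ ∈ C²_c`, a locally integrable drift `b = curl B` a.e. with `B`
differentiable, every constant `c` and `ε > 0`,
`∫ H(F)⟪b, ∇(φ²)⟫ ≤ ε ∫ H''(F)‖∇F‖²φ² + (κ/ε) ∫ H(F) ‖B − c‖² ‖∇φ‖²`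
(`∫ H(F)⟪b, ∇φ²⟫ = ∫ ⟪B − c, ∇(H∘F) × ∇φ²⟫`, `|⟪B − c, ∇(H∘F) × ∇φ²⟫| ≤ ‖B − c‖ |H'(F)| ‖∇F‖ 2|φ|‖∇φ‖`,
Young). [cite: LeiZhang2011, §2 (arXiv p. 6), treatment of b₂] -/
theorem abs_integral_comp_inner_gradient_le_weight {F : EuclideanSpace ℝ (Fin 3) → ℝ}
    (hF : ContDiff ℝ 2 F) {H Gw : ℝ → ℝ} (hH : ContDiff ℝ 1 H) (hH0 : ∀ v, 0 ≤ H v)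
    (hGwc : Continuous Gw) (hGw0 : ∀ v, 0 ≤ Gw v) {κ : ℝ} (hκ0 : 0 ≤ κ)
    (hκ : ∀ v, deriv H v ^ 2 ≤ κ * H v * Gw v)
    {φ : EuclideanSpace ℝ (Fin 3) → ℝ} (hφ : ContDiff ℝ 2 φ) (hφc : HasCompactSupport φ)
    {Bst : EuclideanSpace ℝ (Fin 3) → EuclideanSpace ℝ (Fin 3)} (hBst : Differentiable ℝ Bst)
    {b : EuclideanSpace ℝ (Fin 3) → EuclideanSpace ℝ (Fin 3)} (hb : curl Bst =ᵐ[volume] b)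
    (hbi : LocallyIntegrable b volume) (c : EuclideanSpace ℝ (Fin 3)) {ε : ℝ} (hε : 0 < ε) :
    |∫ x, H (F x) * ⟪b x, gradient (fun y => φ y ^ 2) x⟫| ≤
      ε * (∫ x, Gw (F x) * ‖gradient F x‖ ^ 2 * φ x ^ 2) +
        κ / ε * ∫ x, H (F x) * ‖Bst x - c‖ ^ 2 * ‖gradient φ x‖ ^ 2 := by
  have hφ2c : HasCompactSupport fun y => φ y ^ 2 :=
    hφc.comp_left (g := fun t : ℝ => t ^ 2) (by simp)
  -- through the stream function
  have hHF1 : ContDiff ℝ 1 fun x => H (F x) := hH.comp (hF.of_le one_le_two)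
  rw [integral_mul_inner_gradient_eq_integral_inner_sub_cross hBst hb hbi hHF1 (hφ.pow 2) hφ2c c]
  -- `∇(H∘F) = H'(F)∇F`, `∇(φ²) = 2φ∇φ`
  have hgradHF : ∀ x, gradient (fun y => H (F y)) x = deriv H (F x) • gradient F x := fun x =>
    gradient_comp_apply ((hH.differentiable one_ne_zero) (F x)) ((hF.differentiable two_ne_zero) x)
  have hgrad2 : ∀ x, gradient (fun y => φ y ^ 2) x = (2 * φ x) • gradient φ x := by
    intro x
    have hd : DifferentiableAt ℝ φ x := (hφ.differentiable two_ne_zero) x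
    have h := gradient_comp_apply (H := fun t : ℝ => t ^ 2) (F := φ)
      ((differentiable_pow 2) (φ x)) hd
    simp only [deriv_pow_field, Nat.cast_ofNat, Nat.add_one_sub_one, pow_one] at h
    exact h
  -- pointwise Young
  have hpt : ∀ x, |⟪Bst x - c, cross (gradient (fun y => H (F y)) x) (gradient (fun y => φ y ^ 2) x)⟫| ≤
      ε * (Gw (F x) * ‖gradient F x‖ ^ 2 * φ x ^ 2) +
        κ / ε * (H (F x) * ‖Bst x - c‖ ^ 2 * ‖gradient φ x‖ ^ 2) := by
    intro x
    have h1 := abs_inner_sub_cross_gradient_le Bst c (fun y => H (F y)) (fun y => φ y ^ 2) x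
    have hn1 : ‖gradient (fun y => H (F y)) x‖ = |deriv H (F x)| * ‖gradient F x‖ := by
      rw [hgradHF x, norm_smul, Real.norm_eq_abs]
    have hn2 : ‖gradient (fun y => φ y ^ 2) x‖ = 2 * |φ x| * ‖gradient φ x‖ := by
      rw [hgrad2 x, norm_smul, Real.norm_eq_abs, abs_mul, abs_two]
    rw [hn1, hn2] at h1
    have hY := two_mul_abs_mul_mul_le (‖gradient F x‖ * |φ x|) (‖Bst x - c‖ * ‖gradient φ x‖) hε
      hκ0 (hH0 (F x)) (hGw0 (F x)) (hκ (F x))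
    calc |⟪Bst x - c, cross (gradient (fun y => H (F y)) x) (gradient (fun y => φ y ^ 2) x)⟫|
        ≤ ‖Bst x - c‖ * (|deriv H (F x)| * ‖gradient F x‖ * (2 * |φ x| * ‖gradient φ x‖)) := h1
      _ = 2 * |deriv H (F x)| * (‖gradient F x‖ * |φ x|) * (‖Bst x - c‖ * ‖gradient φ x‖) := by
          ring
      _ ≤ ε * Gw (F x) * (‖gradient F x‖ * |φ x|) ^ 2 +
            κ / ε * H (F x) * (‖Bst x - c‖ * ‖gradient φ x‖) ^ 2 := hY
      _ = _ := by rw [mul_pow, mul_pow, sq_abs]; ring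
  -- integrability of the two bounds
  have hgradF : Continuous (gradient F) := continuous_gradient_of_contDiff (hF.of_le one_le_two)
  have hgradφ : Continuous (gradient φ) := continuous_gradient_of_contDiff (hφ.of_le one_le_two)
  have hc1 : Continuous fun x => Gw (F x) * ‖gradient F x‖ ^ 2 * φ x ^ 2 :=
    ((hGwc.comp hF.continuous).mul (hgradF.norm.pow 2)).mul (hφ.continuous.pow 2)
  have hc2 : Continuous fun x => H (F x) * ‖Bst x - c‖ ^ 2 * ‖gradient φ x‖ ^ 2 :=
    ((hH.continuous.comp hF.continuous).mul
      ((hBst.continuous.sub continuous_const).norm.pow 2)).mul (hgradφ.norm.pow 2)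
  have hi1 : Integrable (fun x => Gw (F x) * ‖gradient F x‖ ^ 2 * φ x ^ 2)
      (volume : Measure (EuclideanSpace ℝ (Fin 3))) :=
    hc1.integrable_of_hasCompactSupport hφ2c.mul_left
  have hgradφc : HasCompactSupport (gradient φ) := by
    refine HasCompactSupport.intro hφc fun x hx => gradient_eq_zero_of_notMem_tsupport hx
  have hi2 : Integrable (fun x => H (F x) * ‖Bst x - c‖ ^ 2 * ‖gradient φ x‖ ^ 2)
      (volume : Measure (EuclideanSpace ℝ (Fin 3))) := by
    refine hc2.integrable_of_hasCompactSupport ?_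
    exact ((hgradφc.norm).comp_left (g := fun t : ℝ => t ^ 2) (by simp)).mul_left
  calc |∫ x, ⟪Bst x - c, cross (gradient (fun y => H (F y)) x) (gradient (fun y => φ y ^ 2) x)⟫|
      ≤ ∫ x, |⟪Bst x - c, cross (gradient (fun y => H (F y)) x) (gradient (fun y => φ y ^ 2) x)⟫| :=
        abs_integral_le_integral_abs
    _ ≤ ∫ x, (ε * (Gw (F x) * ‖gradient F x‖ ^ 2 * φ x ^ 2) +
          κ / ε * (H (F x) * ‖Bst x - c‖ ^ 2 * ‖gradient φ x‖ ^ 2)) :=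
        integral_mono_of_nonneg (Eventually.of_forall fun x => abs_nonneg _)
          ((hi1.const_mul ε).add (hi2.const_mul (κ / ε))) (Eventually.of_forall hpt)
    _ = _ := by
        rw [integral_add (hi1.const_mul ε) (hi2.const_mul (κ / ε)),
          MeasureTheory.integral_const_mul, MeasureTheory.integral_const_mul]

end LeiZhang2011

end Literature.Analysis.FluidPDE
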